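import Literature.Analysis.FluidPDE.ElgindiPolarEnergyTwo
import Literature.Analysis.FluidPDE.ElgindiWordCalculus
import Mathlib.Analysis.Calculus.IteratedDeriv.Lemmas
import HarnessLib

/-!
# Iterated angular derivatives of the profile class: slice calculus and the Leibniz expansions
([Elgindi2021] §7.3–7.4, Proposition 7.7 Steps 4–5 and Proposition 7.9)

Topic `Literature/Analysis/FluidPDE`. Proof file (everything proved, no definitions, no named
facts) on the proof path of the named fact
`Literature.Analysis.FluidPDE.Elgindi.ElgindiGhoulMasmoudi2021_stabilityCore`
(`ElgindiStabilityDecomposition.lean`). T. M. Elgindi, Ann. of Math. 194 (2021) =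
arXiv:1904.04795, §7.4, proof of Proposition 7.9 (p. 23 of the held text):

> "It is natural to consider `Ψ̃ = Ψ/cos(θ)` so that we wish to study:
> `(∂_θ^{k+1}(sin(θ)Ψ̃), ∂_θ^{k+2}(cos(θ)Ψ̃) sin(2θ)^{2k−γ})_{L²_θ}`.
> By induction on `k`, it suffices to consider only the following three terms […]"

(and §7.3 Steps 4–5 for `k = 1, 2`, where the products `∂_θ^{k+1}(sin θΨ̄)·∂_θ^{k+2}(cos θΨ̄)` are
expanded term by term). The expansions are the Leibniz rule for the iterated slice derivatives
`∂_θ^n` of `sin θ·φ(R,θ)` and `cos θ·φ(R,θ)`; this file provides them in the curried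
slice-derivative vocabulary of the tree (`dθ^[n] f R θ = iteratedDeriv n (f R ·) θ`):

* `iterate_dθ_apply`: `dθ^[n] f R θ = iteratedDeriv n (fun θ' => f R θ') θ`;
* `contDiff_iterate_dθ_of_contDiff`, `hasCompactSupport_iterate_dθ`, `iterate_dθ_eq_zero_of_fst_lt`;
* `iterate_dθ_sin_mul`, `iterate_dθ_cos_mul`: **`∂_θ^n(sin θ·φ) = Σ_{a≤n} C(n,a) sin^{(a)}θ·∂_θ^{n−a}φ`**
  and the same with `cos`, with `|sin^{(a)}|, |cos^{(a)}| ≤ 1` (`abs_iteratedDeriv_sin_le_one`);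
* `cos_mul_iterate_dθ_eq`: the top-order extraction
  `cos θ·∂_θ^nφ = ∂_θ^n(cos θ·φ) − Σ_{1≤b≤n} C(n,b) cos^{(b)}θ·∂_θ^{n−b}φ`.
-/

noncomputable section

open MeasureTheory Set Real Filter Function Finset
open _root_.Topology

namespace Literature.Analysis.FluidPDE

namespace Elgindi

/-! ### Iterated slice derivatives -/

/-- `dθ^[n] f R θ = iteratedDeriv n (f R ·) θ`. [folklore] -/
theorem iterate_dθ_apply (n : ℕ) (f : ℝ → ℝ → ℝ) (R θ : ℝ) :
    (dθ^[n] f) R θ = iteratedDeriv n (fun θ' => f R θ') θ := by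
  induction n generalizing f θ with
  | zero => simp
  | succ n ih =>
    rw [Function.iterate_succ_apply, ih (dθ f), iteratedDeriv_succ']
    rfl

/-- The slice of an iterate as a function: `(fun θ => dθ^[n] f R θ) = iteratedDeriv n (f R ·)`. [folklore] -/
theorem iterate_dθ_slice (n : ℕ) (f : ℝ → ℝ → ℝ) (R : ℝ) :
    (fun θ => (dθ^[n] f) R θ) = iteratedDeriv n (fun θ' => f R θ') :=
  funext fun θ => iterate_dθ_apply n f R θ

/-- `∂_θ^n g ∈ Cᵐ(ℝ²)` for `g ∈ C^{m+n}(ℝ²)`. [folklore] -/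
theorem contDiff_iterate_dθ_of_contDiff {g : ℝ → ℝ → ℝ} {n m : ℕ} (hg : ContDiff ℝ ((m + n : ℕ) : WithTop ℕ∞) (uncurry g)) :
    ContDiff ℝ m (uncurry (dθ^[n] g)) := by
  induction n generalizing g with
  | zero => simpa using hg
  | succ n ih =>
    rw [Function.iterate_succ_apply]
    refine ih (g := dθ g) (contDiff_dθ_of_contDiff ?_)
    have e : ((m + (n + 1) : ℕ) : WithTop ℕ∞) = (m + n : ℕ) + 1 := by push_cast; ring
    rw [← e]; exact hg

/-- Iterated angular derivatives keep compact support. [folklore] -/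
theorem hasCompactSupport_iterate_dθ {g : ℝ → ℝ → ℝ} (hs : HasCompactSupport (uncurry g)) (n : ℕ) :
    HasCompactSupport (uncurry (dθ^[n] g)) := by
  induction n generalizing g with
  | zero => simpa using hs
  | succ n ih => rw [Function.iterate_succ_apply]; exact ih (hasCompactSupport_dθ_of hs)

/-- Iterated angular derivatives of a function vanishing for `R < a` vanish for `R < a`. [folklore] -/
theorem iterate_dθ_eq_zero_of_fst_lt {g : ℝ → ℝ → ℝ} {a : ℝ} (hga : ∀ p : ℝ × ℝ, p.1 < a → g p.1 p.2 = 0) (n : ℕ) :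
    ∀ p : ℝ × ℝ, p.1 < a → (dθ^[n] g) p.1 p.2 = 0 := by
  induction n generalizing g with
  | zero => simpa using hga
  | succ n ih =>
    rw [Function.iterate_succ_apply]
    refine ih (g := dθ g) fun p hp => ?_
    show deriv (fun θ' => g p.1 θ') p.2 = 0
    have : (fun θ' => g p.1 θ') = fun _ => 0 := funext fun θ' => hga (p.1, θ') hp
    rw [this, deriv_const]

/-- Iterated angular derivatives of a function vanishing at `θ = θ₀` for all `R`… (not inherited);
instead: the angular iterates commute with multiplication by functions of `R`. [folklore] -/
theorem iterate_dθ_const_mul (n : ℕ) (c : ℝ → ℝ) (f : ℝ → ℝ → ℝ) (R θ : ℝ) :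
    (dθ^[n] fun R θ => c R * f R θ) R θ = c R * (dθ^[n] f) R θ := by
  rw [iterate_dθ_apply, iterate_dθ_apply]
  exact iteratedDeriv_const_mul_field (c R) _

/-! ### Slices of smooth plane functions -/

/-- The angular slice of a `Cⁿ` plane function is `Cⁿ`. [folklore] -/
theorem contDiff_slice_θ {g : ℝ → ℝ → ℝ} {n : WithTop ℕ∞} (hg : ContDiff ℝ n (uncurry g)) (R : ℝ) :
    ContDiff ℝ n fun θ => g R θ :=
  hg.comp (contDiff_const.prodMk contDiff_id)

/-! ### The Leibniz expansions -/

/-- **`∂_θ^n(sin θ·φ(R,θ)) = Σ_{a=0}^{n} C(n,a)·sin^{(a)}(θ)·∂_θ^{n−a}φ(R,θ)`** for `φ ∈ Cⁿ(ℝ²)`.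
[cite: Elgindi2021, §7.4 proof of Proposition 7.9 (p. 23 of arXiv:1904.04795)] -/
theorem iterate_dθ_sin_mul {φ : ℝ → ℝ → ℝ} {n : ℕ} (hφ : ContDiff ℝ n (uncurry φ)) (R θ : ℝ) :
    (dθ^[n] fun R θ => Real.sin θ * φ R θ) R θ =
      ∑ a ∈ range (n + 1), (n.choose a : ℝ) * iteratedDeriv a Real.sin θ * (dθ^[n - a] φ) R θ := by
  rw [iterate_dθ_apply]
  have hs : ContDiffAt ℝ n Real.sin θ := Real.contDiff_sin.contDiffAt
  have hu : ContDiffAt ℝ n (fun θ' => φ R θ') θ := (contDiff_slice_θ hφ R).contDiffAt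
  have h := iteratedDeriv_fun_mul hs hu
  rw [h]
  refine Finset.sum_congr rfl fun a _ => ?_
  rw [iterate_dθ_apply]

/-- **`∂_θ^n(cos θ·φ(R,θ)) = Σ_{b=0}^{n} C(n,b)·cos^{(b)}(θ)·∂_θ^{n−b}φ(R,θ)`** for `φ ∈ Cⁿ(ℝ²)`.
[cite: Elgindi2021, §7.4 proof of Proposition 7.9 (p. 23 of arXiv:1904.04795)] -/
theorem iterate_dθ_cos_mul {φ : ℝ → ℝ → ℝ} {n : ℕ} (hφ : ContDiff ℝ n (uncurry φ)) (R θ : ℝ) :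
    (dθ^[n] fun R θ => Real.cos θ * φ R θ) R θ =
      ∑ b ∈ range (n + 1), (n.choose b : ℝ) * iteratedDeriv b Real.cos θ * (dθ^[n - b] φ) R θ := by
  rw [iterate_dθ_apply]
  have hc : ContDiffAt ℝ n Real.cos θ := Real.contDiff_cos.contDiffAt
  have hu : ContDiffAt ℝ n (fun θ' => φ R θ') θ := (contDiff_slice_θ hφ R).contDiffAt
  have h := iteratedDeriv_fun_mul hc hu
  rw [h]
  refine Finset.sum_congr rfl fun b _ => ?_
  rw [iterate_dθ_apply]

/-- The top-order extraction: **`cos θ·∂_θ^nφ = ∂_θ^n(cos θ·φ) − Σ_{b=1}^{n} C(n,b) cos^{(b)}θ·∂_θ^{n−b}φ`**.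
[cite: Elgindi2021, §7.4 proof of Proposition 7.9 (p. 23 of arXiv:1904.04795)] -/
theorem cos_mul_iterate_dθ_eq {φ : ℝ → ℝ → ℝ} {n : ℕ} (hφ : ContDiff ℝ n (uncurry φ)) (R θ : ℝ) :
    Real.cos θ * (dθ^[n] φ) R θ = (dθ^[n] fun R θ => Real.cos θ * φ R θ) R θ -
      ∑ b ∈ range n, ((n.choose (b + 1) : ℝ) * iteratedDeriv (b + 1) Real.cos θ * (dθ^[n - (b + 1)] φ) R θ) := by
  rw [iterate_dθ_cos_mul hφ, Finset.sum_range_succ']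
  simp

/-- The trigonometric coefficients are bounded by one. [folklore] -/
theorem abs_iteratedDeriv_sin_mul_le (a : ℕ) (θ x : ℝ) : |iteratedDeriv a Real.sin θ * x| ≤ |x| := by
  rw [abs_mul]
  exact (mul_le_mul_of_nonneg_right (abs_iteratedDeriv_sin_le_one a θ) (abs_nonneg x)).trans (by rw [one_mul])

/-- The trigonometric coefficients are bounded by one. [folklore] -/
theorem abs_iteratedDeriv_cos_mul_le (b : ℕ) (θ x : ℝ) : |iteratedDeriv b Real.cos θ * x| ≤ |x| := by
  rw [abs_mul]
  exact (mul_le_mul_of_nonneg_right (abs_iteratedDeriv_cos_le_one b θ) (abs_nonneg x)).trans (by rw [one_mul])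

/-! ### The angular equation of the profile class -/

/-- For `Φ = cos θ·φ` with `φ ∈ C²(ℝ²)`: **`−∂_θθΦ + ∂_θ(sin θ·φ) = 2cos θ·φ + 3sin θ·∂_θφ − cos θ·∂_θθφ`**
(the angular operator in the `sec θΨ` variable; note `tan θ·Φ = sin θ·φ`).
[cite: Elgindi2021, §7.3 proof of Proposition 7.7 Step 4, "−∂_θθΨ + ∂_θ(tan(θ)Ψ) = F₁" with `Ψ̄ = Ψ/cos θ` (p. 22 of arXiv:1904.04795)] -/
theorem angularOp_cosProfile {φ : ℝ → ℝ → ℝ} (hφ : ContDiff ℝ 2 (uncurry φ)) (R θ : ℝ) :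
    -dθ (dθ fun R θ => Real.cos θ * φ R θ) R θ + dθ (fun R θ => Real.sin θ * φ R θ) R θ =
      2 * Real.cos θ * φ R θ + 3 * Real.sin θ * dθ φ R θ - Real.cos θ * dθ (dθ φ) R θ := by
  have hφ1 : ContDiff ℝ 1 (uncurry φ) := hφ.of_le (by norm_num)
  rw [dθ_dθ_cosProfile hφ]
  have hsin : dθ (fun R θ => Real.sin θ * φ R θ) R θ = Real.cos θ * φ R θ + Real.sin θ * dθ φ R θ := by
    have hd : DifferentiableAt ℝ (fun θ' => φ R θ') θ := ((contDiff_slice_θ hφ1 R).differentiable (by simp)) θ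
    show deriv (fun θ' => Real.sin θ' * φ R θ') θ = _
    rw [((Real.hasDerivAt_sin θ).fun_mul hd.hasDerivAt).deriv]
    rfl
  rw [hsin]
  ring

end Elgindi

end Literature.Analysis.FluidPDE
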